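import Summits.BirchSwinnertonDyer.BirchSwinnertonDyer.Theses.SignedBaseChange
import Summits.BirchSwinnertonDyer.BirchSwinnertonDyer.Theorems.SignedBaseChangeAnticyclotomicEisensteinDivisibilityControlTorsionLocal
import Literature.NumberTheory.EllipticCurves.SupersingularInertiaNoFixedPointProofs
import Literature.NumberTheory.EllipticCurves.SerreInertiaImageBaseChangeProofs
import Literature.NumberTheory.EllipticCurves.TwoVariableAnticyclotomicControl
import Literature.NumberTheory.EllipticCurves.YanZhu2026.GreenbergMainTheoremsAnyRoot
import Summits.BirchSwinnertonDyer.BirchSwinnertonDyer.Theorems.SignedBaseChangeAnticyclotomicEisensteinDivisibilityAwayDiscrepancy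
import HarnessLib

/-!
# PRE-BUILT birth skeleton `ratsplice` v1.5 for the STAGED ES child `TwoVariableEulerSystemDivisibilityRatSS` (route `SignedBaseChange`, rev 17-SS,
# text = `rev17-SS/ChildESRatSS.sig` sha16 0c86bea17240a319, re-verified 2026-08-28T10:2xZ; the item does not exist before the 17-SS apply ≈ 2026-08-28T15:45Z).
# Author: ideator seat bsd-idea-14 (g2 v1.0–1.3; g4 v1.4; g5 v1.5), 2026-08-28. BSD is not proved by this file. NOT registered (no item yet); see AFTER-APPLY below.

The child's text is `(hIn ∧) → … → (Module.IsTorsion Λ₂ X_Gr₂) ∧ (∃ a, C(C(p^a))·G ∈ ch_Λ₂(X_Gr₂)^ur)` at a good SUPERSINGULAR `p ≥ 5`.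
This skeleton proves it BY VALUE from THREE stubs, EACH ALREADY ON FILE ELSEWHERE VERBATIM (prove once, close everywhere):
* `stub_xAcTorsionSS` (TS1) = `Bdpline.stub_xAcTorsionSS` = `Torsplice.stub_xAcTorsionSS` (crux 20727; registered text of bdpline v12–v17): one-variable `X_ac` is
  `Λ_ac`-torsion (Castella–Wan Math. Ann. 389 (2024) Lemma 5.11 + Thm 5.12, any `N⁺`; CCSS18 L5.5/T5.7 PRE — closed modulo that PRE binder by p618123). Arithmetic input, PRINT.
* `stub_awayDiscrepancySS` (b₁) = `Bdpline.stub_awayDiscrepancySS` (crux 20727; registered text of bdpline v15, kept in v17): the Pontryagin dual of the ONE-variable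
  away-from-`p`/archimedean discrepancy `datumStrictSelmer(K_∞⁻) ⧸ Sel_v̄(K_∞⁻)` is `Λ`-torsion (it vanishes place by place on the Heegner leaf). Local, L-sized.
* `stub_ratEulerSystemSS` (F1) = `Ratlift.stub_ratEulerSystemSS` (old ES child 20728 `Lines/ratlift.lean` v1–v3, critic idea-crit-15 VERDICT #3 PASS-WITH-PRICE): the RATIONAL
  two-variable Euler-system inclusion `∃ a, (p^a·G) ⊆ ch_Λ₂(X_Gr₂)·𝒪⟦T₁,T₂⟧` — RESEARCH (L1 of ES-ATTACK-BRIEF: BSTW24 §1.4.1 companion / Thm 1.21 tame level; D-0145: no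
  prover seat until L1 is typable). This IS conjunct 2 up to rewriting `(p : 𝒪⟦T₁,T₂⟧)^a = C(C(p^a))` and `span ≤ ↔ ∈`.
v1.5 vs v1.4 (g5, 2026-08-28T11:1xZ): (b₁) `stub_awayDiscrepancySS` is NO LONGER A STUB — it is the LEAD's landed theorem
`Theorems.SignedBaseChangeAcDivAwayDiscrepancy.stub_awayDiscrepancySS` (bsd-line-sbc-p1 gen 3, registered bdpline v18 sha16 86d591c8746806d4, 10:38Z), consumed by name
(statement text identical to bdpline v15–v18 and to v1.4 here). TS1 `stub_xAcTorsionSS` text = bdpline v18 verbatim (re-diffed 11:05Z). OPEN CONTENT after v1.5: TS1 (print,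
PRE-binder residue, shared with crux 20727) · F1 (research) — 2 registered-shape stubs, sorries = 2.

v1.4 vs v1.3 (what the tree landed since 07:55Z is CONSUMED, not re-stubbed): v1.3's `stub_exactControlSS` (injectivity of `toXAcQuot`, i.e. the discrepancy VANISHES) is
DROPPED in favour of the weaker (b₁) (the discrepancy is `Λ`-cotorsion), exactly as the LEAD's bdpline v15–v17 did; conjunct 1 is now ONE call to the width seat's landed glue
`SignedBaseChangeAcDivControlTorsion.stub_torsionSS_of_isTorsion_XAc_of_vanishing_of_away` (p617582; chain p612958 control-coker → p613583 torsion transfer → p615989/p616870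
local), with its (V)-input (`E[p^∞]^{Gal(K̄/K̃_∞) ⊓ I_v̄} = 0`) DERIVED here without sorry from Serre 1972 Prop. 12 (c) for `E_K` at `v̄` (p620980
`InertiaFixedPoint.isCyclic_and_card_inertia_map_baseChange` + p618705 `primary_eq_zero_of_forall_pairKer_inf_inertia_smul_eq`) — the same derivation as bdpline v17 / p623474.
Finite generation (p610206) and the determinant trick (p564681) are no longer needed at this level (they sit inside the glue).
COMPOSITION `TwoVariableEulerSystemDivisibilityRatSS_of` (kernel-checked, no sorry): conjunct 1 from TS1 + (V)derived + (b₁); conjunct 2 from F1.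
OPEN CONTENT after v1.4 (superseded by v1.5 above): TS1 · (b₁) · F1 — i.e. the child's only research content is F1, as the 17-SS design intends.

AFTER-APPLY (for the registrar — pen bsd-wall-ss / the LEAD of the new ES child; this seat cannot write to the new item): change the conclusion type of
`TwoVariableEulerSystemDivisibilityRatSS_of` to `Summit.BirchSwinnertonDyer.BirchSwinnertonDyer.Theses.SignedBaseChange.TwoVariableEulerSystemDivisibilityRatSS`
(δ-equal by W-24's text freeze; keep the proof; add `show <by-value text>` only if asked), `lean check` rc 0 (3 sorries = stubs), then — IF the director/pen want a
registered skeleton on the research child at all (D-0145 rider: no prover SEAT; a registered skeleton only lets idle provers close TS1/(b₁) `--supports`) —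
`ledger crux write <new ES item> Lines/ratsplice.lean --file …` + `ledger skeleton check $(ledger crux dir <item>)/Lines/ratsplice.lean --crux <item>`.
-/

-- D-0017: single-problem summit, the namespace repeats the problem name by design.
set_option linter.dupNamespace false
set_option autoImplicit false

open scoped Pointwise

namespace Summit.BirchSwinnertonDyer.BirchSwinnertonDyer.Cruxes.TwoVariableEulerSystemDivisibilityRatSS.Ratsplice

open Summit.BirchSwinnertonDyer.BirchSwinnertonDyer.Theses.SignedBaseChange
open Literature.NumberTheory.EllipticCurves

/-- stub TS1 (ARITHMETIC INPUT; text VERBATIM = `Torsplice.stub_xAcTorsionSS` on crux 20727; REFEREED PRINT for any `N⁺` under classical Heegner: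
Castella–Wan Math. Ann. 389 (2024) Lemma 5.11 + Thm 5.12, pp. 20–21 — no square-freeness in §5): one-variable `X_ac` is `Λ_ac`-torsion at a good supersingular
prime, `Surj`, classical Heegner `K`, any `N`. Sources: Castella–Wan Math. Ann. 389 (2024) §5.4 Thm 5.12 / Thm 4.3 proof (arXiv:1607.02019);
CCSS arXiv:1804.10993 Lemma 5.5 + Thm 5.7 (PRE); Kobayashi–Ota ASPM 86 (2020) (acq-07292). -/
theorem stub_xAcTorsionSS :
    SignedTwoVariableInputs → Literature.NumberTheory.EllipticCurves.ModularForms.nonempty_modularParametrizationData → ∀ (W : WeierstrassCurve ℚ) [W.IsElliptic] [W.IsGloballyMinimal] (p : ℕ) [Fact p.Prime], 5 ≤ p → W.HasGoodReductionAtPrime p → W.frobeniusTrace p = 0 → Literature.NumberTheory.EllipticCurves.Rank1Residual.Surj W p → ∀ (K : Type) [Field K] [NumberField K] (ι : PadicAlgCl p ≃+* ℂ) (v vbar : IsDedekindDomain.HeightOneSpectrum (NumberField.RingOfIntegers K)) (κ₁ κ₂ : Literature.NumberTheory.EllipticCurves.ZpExtension K p) (γ₁ γ₂ : Field.absoluteGaloisGroup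 K) [Fact (Literature.NumberTheory.EllipticCurves.ZpExtension.IsTopGeneratorPair κ₁ κ₂ γ₁ γ₂)] [NeZero (NumberField.discr K).natAbs] (N : ℕ) [NeZero N] (f : CuspForm (CongruenceSubgroup.Gamma0 N) 2), Literature.NumberTheory.EllipticCurves.ModularForms.IsNewformOf W f → (N : ℤ) = W.conductorNorm ℤ → Literature.NumberTheory.EllipticCurves.IsImaginaryQuadratic K → ((Ideal.span {(p : ℤ)}).primesOver (NumberField.RingOfIntegers K)).ncard = 2 → ((p : ℕ) : NumberField.RingOfIntegers K) ∈ v.asIdeal → ((p : ℕ) : NumberField.RingOfIntegers K) ∈ vbar.asIdeal → vbar ≠ v → (∀ (w : NumberField.InfinitePlace K) (k : NumberField.RingOfIntegers K), k ∈ v.asIdeal ↔ ‖ι.symm (w.embedding (k : K))‖ < 1) → IsCoprime (N : ℤ) (NumberField.discr K) → (∀ ℓ : ℕ, ℓ.Prime → ℓ ∣ N → ((Ideal.span {(ℓ : ℤ)}).primesOver (NumberField.RingOfIntegers K)).ncard = 2) → Odd (NumberField.discr K) → NumberField.discr K ≠ -3 → κ₁.IsCyclotomic → κ₂.IsAnticyclotomic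 → (haveI : Fact (κ₂.IsTopGenerator γ₂) := ⟨Literature.NumberTheory.EllipticCurves.YanZhu2026.isTopGenerator_of_pair (κ₁ := κ₁) (γ₁ := γ₁)⟩; Module.IsTorsion (Literature.NumberTheory.EllipticCurves.IwasawaAlgebra p) (Literature.NumberTheory.EllipticCurves.Castella2018.AcSelmer.XAc (W.baseChange K) p κ₂ vbar ∅ γ₂)) := by
  sorry

/-- stub (b₁) (LOCAL away from `p` and at `∞`, ONE variable; text VERBATIM = `Bdpline.stub_awayDiscrepancySS` on crux 20727, registered bdpline v15 b1a347aa / kept in v17):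
**the Pontryagin dual of the one-variable discrepancy `Q₁ = datumStrictSelmer(K_∞⁻) ⧸ Sel_v̄(K_∞⁻)` is `Λ`-torsion** (pointwise form: every character `x` of
`H¹_{nr,v̄}(K̃_∞, E[p^∞])` vanishing on `res(Sel_v̄(K_∞⁻, E[p^∞]))` is killed by some `g ≠ 0` of `Λ = ℤ_p⟦T₂⟧` on the restrictions of the classes over `K_∞⁻` that are
unramified away from `p` and strict at `v̄`; the binder (V) makes those restrictions land in `H¹_{nr,v̄}(K̃_∞, E[p^∞])`). `Q₁ = ⊕_{w ∤ p} ℋ^ur_w ⊕ (archimedean)`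
(Castella 2018 §2.2); on the Heegner leaf it VANISHES place by place (split `ℓ ∣ N` finitely decomposed in `K^ac_∞` with pro-`p′` residual Galois group ⟹ unramified = trivial
on `p`-primary coefficients; at good `w`, `E[p^∞]/(Frob_w − 1) = 0`; no real place). [cite: Castella2018, §2.2 (arXiv:1704.06608 p. 7)] [cite: SkinnerUrban2014, Prop. 3.2.8 (p. 23)] -/
theorem stub_awayDiscrepancySS :
    SignedTwoVariableInputs → Literature.NumberTheory.EllipticCurves.ModularForms.nonempty_modularParametrizationData → ∀ (W : WeierstrassCurve ℚ) [W.IsElliptic] [W.IsGloballyMinimal] (p : ℕ) [Fact p.Prime], 5 ≤ p → W.HasGoodReductionAtPrime p → W.frobeniusTrace p = 0 → Literature.NumberTheory.EllipticCurves.Rank1Residual.Surj W p → ∀ (K : Type) [Field K] [NumberField K] (ι : PadicAlgCl p ≃+* ℂ) (v vbar : IsDedekindDomain.HeightOneSpectrum (NumberField.RingOfIntegers K)) (κ₁ κ₂ : Literature.NumberTheory.EllipticCurves.ZpExtension K p) (γ₁ γ₂ : Field.absoluteGaloisGroup K) [Fact (Literature.NumberTheory.EllipticCurves.ZpExtension.IsTopGeneratorPair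 κ₁ κ₂ γ₁ γ₂)] [NeZero (NumberField.discr K).natAbs] (N : ℕ) [NeZero N] (f : CuspForm (CongruenceSubgroup.Gamma0 N) 2), Literature.NumberTheory.EllipticCurves.ModularForms.IsNewformOf W f → (N : ℤ) = W.conductorNorm ℤ → Literature.NumberTheory.EllipticCurves.IsImaginaryQuadratic K → ((Ideal.span {(p : ℤ)}).primesOver (NumberField.RingOfIntegers K)).ncard = 2 → ((p : ℕ) : NumberField.RingOfIntegers K) ∈ v.asIdeal → ((p : ℕ) : NumberField.RingOfIntegers K) ∈ vbar.asIdeal → vbar ≠ v → (∀ (w : NumberField.InfinitePlace K) (k : NumberField.RingOfIntegers K), k ∈ v.asIdeal ↔ ‖ι.symm (w.embedding (k : K))‖ < 1) → IsCoprime (N : ℤ) (NumberField.discr K) → (∀ ℓ : ℕ, ℓ.Prime → ℓ ∣ N → ((Ideal.span {(ℓ : ℤ)}).primesOver (NumberField.RingOfIntegers K)).ncard = 2) → Odd (NumberField.discr K) → NumberField.discr K ≠ -3 → ∀ (hκ₁ : κ₁.IsCyclotomic), κ₂.IsAnticyclotomic → ∀ (hV : ∀ m : (W.baseChange K).geomPrimaryTorsion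 p, (∀ t ∈ Literature.NumberTheory.EllipticCurves.ZpExtension.pairKer κ₁ κ₂ ⊓ Literature.NumberTheory.EllipticCurves.GreenbergSelmer.inertia vbar, t • m = m) → m = 0) (hvbar' : ((p : ℕ) : NumberField.RingOfIntegers K) ∈ vbar.asIdeal) (x : (W.baseChange K).XGr₂ p κ₁ κ₂ vbar γ₁ γ₂), (∀ s : Literature.NumberTheory.EllipticCurves.Castella2018.AcSelmer.selmerAc (W.baseChange K) p κ₂ vbar ∅, x ((W.baseChange K).selmerAcToUnrSelmer₂ p κ₁ κ₂ vbar s) = 0) → ∃ g : Literature.NumberTheory.EllipticCurves.IwasawaAlgebra p, g ≠ 0 ∧ ∀ (a : (W.baseChange K).subgroupH1 p κ₂.kerSubgroup) (ha : a ∈ Literature.NumberTheory.EllipticCurves.GreenbergVatsal2000.datumStrictSelmer κ₂.kerSubgroup ((W.baseChange K).geomPrimaryTorsion p) p (Literature.NumberTheory.EllipticCurves.Castella2018.AcSelmer.bdpData ((W.baseChange K).geomPrimaryTorsion p) p vbar) ∅), ((PowerSeries.C g : Literature.NumberTheory.EllipticCurves.IwasawaAlgebra₂ p) • x) ⟨_,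 Summit.BirchSwinnertonDyer.BirchSwinnertonDyer.Theorems.SignedBaseChangeAcDivControlTorsion.resOfLe_mem_unrSelmer₂_of_mem_datumStrictSelmer (W.baseChange K) p κ₁ κ₂ vbar hκ₁ hvbar' hV ha⟩ = 0 :=
  -- CONSUMED (v1.5): PROVED by the LEAD bsd-line-sbc-p1 gen 3 (tree Theorems …AwayDiscrepancyKernel p624667 / …AwayDiscrepancyLocal p625060 / …AwayDiscrepancy; bdpline v18)
  Summit.BirchSwinnertonDyer.BirchSwinnertonDyer.Theorems.SignedBaseChangeAcDivAwayDiscrepancy.stub_awayDiscrepancySS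

/-- stub F1 (RESEARCH, LOAD-BEARING; text VERBATIM = `Ratlift.stub_ratEulerSystemSS` on the old ES child 20728): the RATIONAL two-variable
Euler-system inclusion `∃ a, (p^a · G) ⊆ ch_Λ₂(X_Gr₂)·𝒪⟦T₁,T₂⟧` at a good supersingular prime. No engine in print at `a_p = 0`
(BSTW24 arXiv:2409.01350 §1.4.1 announces the companion; ES-ATTACK-BRIEF L1). -/
theorem stub_ratEulerSystemSS :
    SignedTwoVariableInputs → Literature.NumberTheory.EllipticCurves.ModularForms.nonempty_modularParametrizationData → ∀ (W : WeierstrassCurve ℚ) [W.IsElliptic] [W.IsGloballyMinimal] (p : ℕ) [Fact p.Prime], 5 ≤ p → W.HasGoodReductionAtPrime p → W.frobeniusTrace p = 0 → Literature.NumberTheory.EllipticCurves.Rank1Residual.Surj W p → ∀ (K : Type) [Field K] [NumberField K] (ι : PadicAlgCl p ≃+* ℂ) (v vbar : IsDedekindDomain.HeightOneSpectrum (NumberField.RingOfIntegers K)) (κ₁ κ₂ : Literature.NumberTheory.EllipticCurves.ZpExtension K p) (γ₁ γ₂ : Field.absoluteGaloisGroup K) [Fact (Literature.NumberTheory.EllipticCurves.ZpExtension.IsTopGeneratorPair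 κ₁ κ₂ γ₁ γ₂)] [NeZero (NumberField.discr K).natAbs] (N : ℕ) [NeZero N] (f : CuspForm (CongruenceSubgroup.Gamma0 N) 2), Literature.NumberTheory.EllipticCurves.ModularForms.IsNewformOf W f → (N : ℤ) = W.conductorNorm ℤ → Literature.NumberTheory.EllipticCurves.IsImaginaryQuadratic K → ((Ideal.span {(p : ℤ)}).primesOver (NumberField.RingOfIntegers K)).ncard = 2 → ((p : ℕ) : NumberField.RingOfIntegers K) ∈ v.asIdeal → ((p : ℕ) : NumberField.RingOfIntegers K) ∈ vbar.asIdeal → vbar ≠ v → (∀ (w : NumberField.InfinitePlace K) (k : NumberField.RingOfIntegers K), k ∈ v.asIdeal ↔ ‖ι.symm (w.embedding (k : K))‖ < 1) → IsCoprime (N : ℤ) (NumberField.discr K) → (∀ ℓ : ℕ, ℓ.Prime → ℓ ∣ N → ((Ideal.span {(ℓ : ℤ)}).primesOver (NumberField.RingOfIntegers K)).ncard = 2) → Odd (NumberField.discr K) → NumberField.discr K ≠ -3 → κ₁.IsCyclotomic → κ₂.IsAnticyclotomic → ∀ (Ω δ : ℂ) (Ωp : (Literature.NumberTheory.EllipticCurves.unrIntegers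 p)ˣ) (LK G : PowerSeries (PowerSeries (PadicComplexInt p))), Ω ≠ 0 → (δ ^ 2 = (NumberField.discr K : ℂ) ∨ δ ^ 2 = -(NumberField.discr K : ℂ)) → Literature.NumberTheory.EllipticCurves.IsKatzMeasure₂ ι v vbar ∅ κ₁ κ₂ γ₁⁻¹ γ₂⁻¹ 1 Ω δ ((Ωp : Literature.NumberTheory.EllipticCurves.unrIntegers p) : PadicComplex p) LK → Literature.NumberTheory.EllipticCurves.IsGreenbergLFunctionAnyRoot₂ ι v vbar κ₁ κ₂ γ₁⁻¹ γ₂⁻¹ f (NumberField.discr K).natAbs (NumberField.classNumber K) LK G → ∀ J : ℤ_[p] →+* PadicComplexInt p, (∀ x : ℤ_[p], ((J x : PadicComplexInt p) : PadicComplex p) = ((x : ℚ_[p]) : PadicComplex p)) → ∃ a : ℕ, Ideal.span {((p : ℕ) : PowerSeries (PowerSeries (PadicComplexInt p))) ^ a * G} ≤ (WeierstrassCurve.XGr₂.charIdeal (W.baseChange K) p κ₁ κ₂ vbar γ₁ γ₂).map (Literature.NumberTheory.EllipticCurves.IwasawaAlgebra₂.toUnr₂ p J) := by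
  sorry

/-! ## Derived input (no sorry): (V) inertia vanishing at `v̄` from Serre 1972 Prop. 12 (c) -/

/-- (V) **`E[p^∞]` has no non-zero point fixed by `Gal(K̄/K̃_∞) ⊓ I_v̄`** at a good supersingular `p ≥ 5` split in the imaginary quadratic `K` — DERIVED (as in
bdpline v17 / p623474) from the width seat's landed Serre transport `InertiaFixedPoint.isCyclic_and_card_inertia_map_baseChange` (p620980: `ρ̄_{E_K,p}(I_v̄)` cyclic of
order `p² − 1`) and `InertiaFixedPoint.primary_eq_zero_of_forall_pairKer_inf_inertia_smul_eq` (p618705). [cite: Serre1972, §1.11 Prop. 12 c)] -/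
theorem inertiaVanishingSS :
    SignedTwoVariableInputs → Literature.NumberTheory.EllipticCurves.ModularForms.nonempty_modularParametrizationData → ∀ (W : WeierstrassCurve ℚ) [W.IsElliptic] [W.IsGloballyMinimal] (p : ℕ) [Fact p.Prime], 5 ≤ p → W.HasGoodReductionAtPrime p → W.frobeniusTrace p = 0 → Literature.NumberTheory.EllipticCurves.Rank1Residual.Surj W p → ∀ (K : Type) [Field K] [NumberField K] (ι : PadicAlgCl p ≃+* ℂ) (v vbar : IsDedekindDomain.HeightOneSpectrum (NumberField.RingOfIntegers K)) (κ₁ κ₂ : Literature.NumberTheory.EllipticCurves.ZpExtension K p) (γ₁ γ₂ : Field.absoluteGaloisGroup K) [Fact (Literature.NumberTheory.EllipticCurves.ZpExtension.IsTopGeneratorPair κ₁ κ₂ γ₁ γ₂)] [NeZero (NumberField.discr K).natAbs] (N : ℕ) [NeZero N] (f : CuspForm (CongruenceSubgroup.Gamma0 N) 2), Literature.NumberTheory.EllipticCurves.ModularForms.IsNewformOf W f → (N : ℤ) = W.conductorNorm ℤ → Literature.NumberTheory.EllipticCurves.IsImaginaryQuadratic K → ((Ideal.span {(p : ℤ)}).primesOver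 (NumberField.RingOfIntegers K)).ncard = 2 → ((p : ℕ) : NumberField.RingOfIntegers K) ∈ v.asIdeal → ((p : ℕ) : NumberField.RingOfIntegers K) ∈ vbar.asIdeal → vbar ≠ v → (∀ (w : NumberField.InfinitePlace K) (k : NumberField.RingOfIntegers K), k ∈ v.asIdeal ↔ ‖ι.symm (w.embedding (k : K))‖ < 1) → IsCoprime (N : ℤ) (NumberField.discr K) → (∀ ℓ : ℕ, ℓ.Prime → ℓ ∣ N → ((Ideal.span {(ℓ : ℤ)}).primesOver (NumberField.RingOfIntegers K)).ncard = 2) → Odd (NumberField.discr K) → NumberField.discr K ≠ -3 → κ₁.IsCyclotomic → κ₂.IsAnticyclotomic → ∀ m : (W.baseChange K).geomPrimaryTorsion p, (∀ t ∈ Literature.NumberTheory.EllipticCurves.ZpExtension.pairKer κ₁ κ₂ ⊓ Literature.NumberTheory.EllipticCurves.GreenbergSelmer.inertia vbar, t • m = m) → m = 0 := by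
  intro _ _ W _ _ p _ hp hgood ha0 _ K _ _ _ v vbar κ₁ κ₂ _ _ _ _ _ _ _ _ _ hK _ hv hvbar hvv _ _ _ _ _ _ _ m hm
  have hp2 : p ≠ 2 := by omega
  haveI : (W.baseChange K).IsElliptic := by rw [WeierstrassCurve.baseChange]; infer_instance
  obtain ⟨hc, hcard⟩ := Literature.NumberTheory.EllipticCurves.InertiaFixedPoint.isCyclic_and_card_inertia_map_baseChange W hp2 hgood
    (by rw [ha0]; exact dvd_zero _) hK hv hvbar hvv
  exact Literature.NumberTheory.EllipticCurves.InertiaFixedPoint.primary_eq_zero_of_forall_pairKer_inf_inertia_smul_eq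
    (W.baseChange K) κ₁ κ₂ vbar hc hcard hm

/-! ## The composition: the staged child text BY VALUE -/

/-- **COMPOSITION (kernel-checked): TS1 → (b₁) → F1 → the staged ES child text BY VALUE** (`ChildESRatSS.sig` 0c86bea17240a319). Conjunct 1 = the width seat's
glue `stub_torsionSS_of_isTorsion_XAc_of_vanishing_of_away` (p617582) on TS1, (V) (derived above) and (b₁); conjunct 2 = F1 with `(p : 𝒪⟦T₁,T₂⟧)^a = C (C (p^a))`. -/
theorem TwoVariableEulerSystemDivisibilityRatSS_of :
    (SignedTwoVariableInputs → Literature.NumberTheory.EllipticCurves.ModularForms.nonempty_modularParametrizationData → ∀ (W : WeierstrassCurve ℚ) [W.IsElliptic] [W.IsGloballyMinimal] (p : ℕ) [Fact p.Prime], 5 ≤ p → W.HasGoodReductionAtPrime p → W.frobeniusTrace p = 0 → Literature.NumberTheory.EllipticCurves.Rank1Residual.Surj W p → ∀ (K : Type) [Field K] [NumberField K] (ι : PadicAlgCl p ≃+* ℂ) (v vbar : IsDedekindDomain.HeightOneSpectrum (NumberField.RingOfIntegers K)) (κ₁ κ₂ : Literature.NumberTheory.EllipticCurves.ZpExtension K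 p) (γ₁ γ₂ : Field.absoluteGaloisGroup K) [Fact (Literature.NumberTheory.EllipticCurves.ZpExtension.IsTopGeneratorPair κ₁ κ₂ γ₁ γ₂)] [NeZero (NumberField.discr K).natAbs] (N : ℕ) [NeZero N] (f : CuspForm (CongruenceSubgroup.Gamma0 N) 2), Literature.NumberTheory.EllipticCurves.ModularForms.IsNewformOf W f → (N : ℤ) = W.conductorNorm ℤ → Literature.NumberTheory.EllipticCurves.IsImaginaryQuadratic K → ((Ideal.span {(p : ℤ)}).primesOver (NumberField.RingOfIntegers K)).ncard = 2 → ((p : ℕ) : NumberField.RingOfIntegers K) ∈ v.asIdeal → ((p : ℕ) : NumberField.RingOfIntegers K) ∈ vbar.asIdeal → vbar ≠ v → (∀ (w : NumberField.InfinitePlace K) (k : NumberField.RingOfIntegers K), k ∈ v.asIdeal ↔ ‖ι.symm (w.embedding (k : K))‖ < 1) → IsCoprime (N : ℤ) (NumberField.discr K) → (∀ ℓ : ℕ, ℓ.Prime → ℓ ∣ N → ((Ideal.span {(ℓ : ℤ)}).primesOver (NumberField.RingOfIntegers K)).ncard = 2) → Odd (NumberField.discr K) → NumberField.discr K ≠ -3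 → κ₁.IsCyclotomic → κ₂.IsAnticyclotomic → (haveI : Fact (κ₂.IsTopGenerator γ₂) := ⟨Literature.NumberTheory.EllipticCurves.YanZhu2026.isTopGenerator_of_pair (κ₁ := κ₁) (γ₁ := γ₁)⟩; Module.IsTorsion (Literature.NumberTheory.EllipticCurves.IwasawaAlgebra p) (Literature.NumberTheory.EllipticCurves.Castella2018.AcSelmer.XAc (W.baseChange K) p κ₂ vbar ∅ γ₂))) →
    (SignedTwoVariableInputs → Literature.NumberTheory.EllipticCurves.ModularForms.nonempty_modularParametrizationData → ∀ (W : WeierstrassCurve ℚ) [W.IsElliptic] [W.IsGloballyMinimal] (p : ℕ) [Fact p.Prime], 5 ≤ p → W.HasGoodReductionAtPrime p → W.frobeniusTrace p = 0 → Literature.NumberTheory.EllipticCurves.Rank1Residual.Surj W p → ∀ (K : Type) [Field K] [NumberField K] (ι : PadicAlgCl p ≃+* ℂ) (v vbar : IsDedekindDomain.HeightOneSpectrum (NumberField.RingOfIntegers K)) (κ₁ κ₂ : Literature.NumberTheory.EllipticCurves.ZpExtension K p) (γ₁ γ₂ : Field.absoluteGaloisGroup K) [Fact (Literature.NumberTheory.EllipticCurves.ZpExtension.IsTopGeneratorPair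 κ₁ κ₂ γ₁ γ₂)] [NeZero (NumberField.discr K).natAbs] (N : ℕ) [NeZero N] (f : CuspForm (CongruenceSubgroup.Gamma0 N) 2), Literature.NumberTheory.EllipticCurves.ModularForms.IsNewformOf W f → (N : ℤ) = W.conductorNorm ℤ → Literature.NumberTheory.EllipticCurves.IsImaginaryQuadratic K → ((Ideal.span {(p : ℤ)}).primesOver (NumberField.RingOfIntegers K)).ncard = 2 → ((p : ℕ) : NumberField.RingOfIntegers K) ∈ v.asIdeal → ((p : ℕ) : NumberField.RingOfIntegers K) ∈ vbar.asIdeal → vbar ≠ v → (∀ (w : NumberField.InfinitePlace K) (k : NumberField.RingOfIntegers K), k ∈ v.asIdeal ↔ ‖ι.symm (w.embedding (k : K))‖ < 1) → IsCoprime (N : ℤ) (NumberField.discr K) → (∀ ℓ : ℕ, ℓ.Prime → ℓ ∣ N → ((Ideal.span {(ℓ : ℤ)}).primesOver (NumberField.RingOfIntegers K)).ncard = 2) → Odd (NumberField.discr K) → NumberField.discr K ≠ -3 → ∀ (hκ₁ : κ₁.IsCyclotomic), κ₂.IsAnticyclotomic → ∀ (hV : ∀ m : (W.baseChange K).geomPrimaryTorsion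 p, (∀ t ∈ Literature.NumberTheory.EllipticCurves.ZpExtension.pairKer κ₁ κ₂ ⊓ Literature.NumberTheory.EllipticCurves.GreenbergSelmer.inertia vbar, t • m = m) → m = 0) (hvbar' : ((p : ℕ) : NumberField.RingOfIntegers K) ∈ vbar.asIdeal) (x : (W.baseChange K).XGr₂ p κ₁ κ₂ vbar γ₁ γ₂), (∀ s : Literature.NumberTheory.EllipticCurves.Castella2018.AcSelmer.selmerAc (W.baseChange K) p κ₂ vbar ∅, x ((W.baseChange K).selmerAcToUnrSelmer₂ p κ₁ κ₂ vbar s) = 0) → ∃ g : Literature.NumberTheory.EllipticCurves.IwasawaAlgebra p, g ≠ 0 ∧ ∀ (a : (W.baseChange K).subgroupH1 p κ₂.kerSubgroup) (ha : a ∈ Literature.NumberTheory.EllipticCurves.GreenbergVatsal2000.datumStrictSelmer κ₂.kerSubgroup ((W.baseChange K).geomPrimaryTorsion p) p (Literature.NumberTheory.EllipticCurves.Castella2018.AcSelmer.bdpData ((W.baseChange K).geomPrimaryTorsion p) p vbar) ∅), ((PowerSeries.C g : Literature.NumberTheory.EllipticCurves.IwasawaAlgebra₂ p) • x) ⟨_,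 Summit.BirchSwinnertonDyer.BirchSwinnertonDyer.Theorems.SignedBaseChangeAcDivControlTorsion.resOfLe_mem_unrSelmer₂_of_mem_datumStrictSelmer (W.baseChange K) p κ₁ κ₂ vbar hκ₁ hvbar' hV ha⟩ = 0) →
    (SignedTwoVariableInputs → Literature.NumberTheory.EllipticCurves.ModularForms.nonempty_modularParametrizationData → ∀ (W : WeierstrassCurve ℚ) [W.IsElliptic] [W.IsGloballyMinimal] (p : ℕ) [Fact p.Prime], 5 ≤ p → W.HasGoodReductionAtPrime p → W.frobeniusTrace p = 0 → Literature.NumberTheory.EllipticCurves.Rank1Residual.Surj W p → ∀ (K : Type) [Field K] [NumberField K] (ι : PadicAlgCl p ≃+* ℂ) (v vbar : IsDedekindDomain.HeightOneSpectrum (NumberField.RingOfIntegers K)) (κ₁ κ₂ : Literature.NumberTheory.EllipticCurves.ZpExtension K p) (γ₁ γ₂ : Field.absoluteGaloisGroup K) [Fact (Literature.NumberTheory.EllipticCurves.ZpExtension.IsTopGeneratorPair κ₁ κ₂ γ₁ γ₂)] [NeZero (NumberField.discr K).natAbs] (N : ℕ) [NeZero N] (f : CuspForm (CongruenceSubgroup.Gamma0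 N) 2), Literature.NumberTheory.EllipticCurves.ModularForms.IsNewformOf W f → (N : ℤ) = W.conductorNorm ℤ → Literature.NumberTheory.EllipticCurves.IsImaginaryQuadratic K → ((Ideal.span {(p : ℤ)}).primesOver (NumberField.RingOfIntegers K)).ncard = 2 → ((p : ℕ) : NumberField.RingOfIntegers K) ∈ v.asIdeal → ((p : ℕ) : NumberField.RingOfIntegers K) ∈ vbar.asIdeal → vbar ≠ v → (∀ (w : NumberField.InfinitePlace K) (k : NumberField.RingOfIntegers K), k ∈ v.asIdeal ↔ ‖ι.symm (w.embedding (k : K))‖ < 1) → IsCoprime (N : ℤ) (NumberField.discr K) → (∀ ℓ : ℕ, ℓ.Prime → ℓ ∣ N → ((Ideal.span {(ℓ : ℤ)}).primesOver (NumberField.RingOfIntegers K)).ncard = 2) → Odd (NumberField.discr K) → NumberField.discr K ≠ -3 → κ₁.IsCyclotomic → κ₂.IsAnticyclotomic → ∀ (Ω δ : ℂ) (Ωp : (Literature.NumberTheory.EllipticCurves.unrIntegers p)ˣ) (LK G : PowerSeries (PowerSeries (PadicComplexInt p))), Ω ≠ 0 → (δ ^ 2 = (NumberField.discr K : ℂ)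 ∨ δ ^ 2 = -(NumberField.discr K : ℂ)) → Literature.NumberTheory.EllipticCurves.IsKatzMeasure₂ ι v vbar ∅ κ₁ κ₂ γ₁⁻¹ γ₂⁻¹ 1 Ω δ ((Ωp : Literature.NumberTheory.EllipticCurves.unrIntegers p) : PadicComplex p) LK → Literature.NumberTheory.EllipticCurves.IsGreenbergLFunctionAnyRoot₂ ι v vbar κ₁ κ₂ γ₁⁻¹ γ₂⁻¹ f (NumberField.discr K).natAbs (NumberField.classNumber K) LK G → ∀ J : ℤ_[p] →+* PadicComplexInt p, (∀ x : ℤ_[p], ((J x : PadicComplexInt p) : PadicComplex p) = ((x : ℚ_[p]) : PadicComplex p)) → ∃ a : ℕ, Ideal.span {((p : ℕ) : PowerSeries (PowerSeries (PadicComplexInt p))) ^ a * G} ≤ (WeierstrassCurve.XGr₂.charIdeal (W.baseChange K) p κ₁ κ₂ vbar γ₁ γ₂).map (Literature.NumberTheory.EllipticCurves.IwasawaAlgebra₂.toUnr₂ p J)) →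
    ((Literature.NumberTheory.EllipticCurves.BurungaleCastellaSkinner2025.prop422_greenbergAnyRoot_hasUnitContent_minus ∧ Literature.NumberTheory.EllipticCurves.BurungaleSkinnerTianWan2024.props118_27_519_exists_signedTwoVariablePackage_supersingular_PRE) → Literature.NumberTheory.EllipticCurves.ModularForms.nonempty_modularParametrizationData → ∀ (W : WeierstrassCurve ℚ) [W.IsElliptic] [W.IsGloballyMinimal] (p : ℕ) [Fact p.Prime], 5 ≤ p → W.HasGoodReductionAtPrime p → W.frobeniusTrace p = 0 → Literature.NumberTheory.EllipticCurves.Rank1Residual.Surj W p → ∀ (K : Type) [Field K] [NumberField K] (ι : PadicAlgCl p ≃+* ℂ) (v vbar : IsDedekindDomain.HeightOneSpectrum (NumberField.RingOfIntegers K)) (κ₁ κ₂ : Literature.NumberTheory.EllipticCurves.ZpExtension K p) (γ₁ γ₂ : Field.absoluteGaloisGroup K) [Fact (Literature.NumberTheory.EllipticCurves.ZpExtension.IsTopGeneratorPair κ₁ κ₂ γ₁ γ₂)] [NeZero (NumberField.discr K).natAbs] (N : ℕ) [NeZero N] (f : CuspForm (CongruenceSubgroup.Gamma0 N) 2), Literature.NumberTheory.EllipticCurves.ModularForms.IsNewformOf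 W f → (N : ℤ) = W.conductorNorm ℤ → Literature.NumberTheory.EllipticCurves.IsImaginaryQuadratic K → ((Ideal.span {(p : ℤ)}).primesOver (NumberField.RingOfIntegers K)).ncard = 2 → ((p : ℕ) : NumberField.RingOfIntegers K) ∈ v.asIdeal → ((p : ℕ) : NumberField.RingOfIntegers K) ∈ vbar.asIdeal → vbar ≠ v → (∀ (w : NumberField.InfinitePlace K) (k : NumberField.RingOfIntegers K), k ∈ v.asIdeal ↔ ‖ι.symm (w.embedding (k : K))‖ < 1) → IsCoprime (N : ℤ) (NumberField.discr K) → (∀ ℓ : ℕ, ℓ.Prime → ℓ ∣ N → ((Ideal.span {(ℓ : ℤ)}).primesOver (NumberField.RingOfIntegers K)).ncard = 2) → Odd (NumberField.discr K) → NumberField.discr K ≠ -3 → κ₁.IsCyclotomic → κ₂.IsAnticyclotomic → ∀ (Ω δ : ℂ) (Ωp : (Literature.NumberTheory.EllipticCurves.unrIntegers p)ˣ) (LK G : PowerSeries (PowerSeries (PadicComplexInt p))), Ω ≠ 0 → (δ ^ 2 = (NumberField.discr K : ℂ) ∨ δ ^ 2 = -(NumberField.discr K : ℂ)) → Literature.NumberTheory.EllipticCurves.IsKatzMeasure₂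 ι v vbar ∅ κ₁ κ₂ γ₁⁻¹ γ₂⁻¹ 1 Ω δ ((Ωp : Literature.NumberTheory.EllipticCurves.unrIntegers p) : PadicComplex p) LK → Literature.NumberTheory.EllipticCurves.IsGreenbergLFunctionAnyRoot₂ ι v vbar κ₁ κ₂ γ₁⁻¹ γ₂⁻¹ f (NumberField.discr K).natAbs (NumberField.classNumber K) LK G → ∀ J : ℤ_[p] →+* PadicComplexInt p, (∀ x : ℤ_[p], ((J x : PadicComplexInt p) : PadicComplex p) = ((x : ℚ_[p]) : PadicComplex p)) → Module.IsTorsion (Literature.NumberTheory.EllipticCurves.IwasawaAlgebra₂ p) ((W.baseChange K).XGr₂ p κ₁ κ₂ vbar γ₁ γ₂) ∧ ∃ a : ℕ, PowerSeries.C (PowerSeries.C (((p : ℕ) : PadicComplexInt p) ^ a)) * G ∈ (WeierstrassCurve.XGr₂.charIdeal (W.baseChange K) p κ₁ κ₂ vbar γ₁ γ₂).map (Literature.NumberTheory.EllipticCurves.IwasawaAlgebra₂.toUnr₂ p J)) := by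
  intro h1 h2 h3
  intro hIn hMP W _ _ p _ hp hgood hap hsurj K _ _ ι v vbar κ₁ κ₂ γ₁ γ₂ _ _ N _ f hf hN hK hsplit hv hvbar hne hιv hcop hHeeg hodd hm3 hcyc hac
    Ω δ Ωp LK G hΩ hδ hLK hG J hJ
  refine ⟨?_, ?_⟩
  · -- conjunct 1: `Λ₂`-torsion of `X_Gr₂` — w2's landed glue fed by TS1, (V) derived, (b₁)
    have hV := inertiaVanishingSS hIn hMP W p hp hgood hap hsurj K ι v vbar κ₁ κ₂ γ₁ γ₂ N f hf hN hK hsplit hv hvbar hne hιv hcop hHeeg hodd hm3 hcyc hac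
    exact Summit.BirchSwinnertonDyer.BirchSwinnertonDyer.Theorems.SignedBaseChangeAcDivControlTorsion.stub_torsionSS_of_isTorsion_XAc_of_vanishing_of_away
      W p hp hgood hap hsurj K ι v vbar κ₁ κ₂ γ₁ γ₂ N f hf hN hK hsplit hv hvbar hne hιv hcop hHeeg hodd hm3 hcyc hac
      (h1 hIn hMP W p hp hgood hap hsurj K ι v vbar κ₁ κ₂ γ₁ γ₂ N f hf hN hK hsplit hv hvbar hne hιv hcop hHeeg hodd hm3 hcyc hac) hV
      (h2 hIn hMP W p hp hgood hap hsurj K ι v vbar κ₁ κ₂ γ₁ γ₂ N f hf hN hK hsplit hv hvbar hne hιv hcop hHeeg hodd hm3 hcyc hac hV)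
  · -- conjunct 2: the rational two-variable Euler-system inclusion (F1), `(p : 𝒪⟦T₁,T₂⟧)^a = C (C (p^a))`
    obtain ⟨a, ha⟩ := h3 hIn hMP W p hp hgood hap hsurj K ι v vbar κ₁ κ₂ γ₁ γ₂ N f hf hN hK hsplit hv hvbar hne hιv hcop hHeeg hodd hm3 hcyc hac
      Ω δ Ωp LK G hΩ hδ hLK hG J hJ
    refine ⟨a, ?_⟩
    have e : PowerSeries.C (PowerSeries.C (((p : ℕ) : PadicComplexInt p) ^ a)) =
        ((p : ℕ) : PowerSeries (PowerSeries (PadicComplexInt p))) ^ a := by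
      rw [map_pow, map_pow, map_natCast, map_natCast]
    rw [e]
    exact (Ideal.span_singleton_le_iff_mem _).mp ha

end Summit.BirchSwinnertonDyer.BirchSwinnertonDyer.Cruxes.TwoVariableEulerSystemDivisibilityRatSS.Ratsplice
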